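import Literature.MathematicalPhysics.QuantumFieldTheory.Balaban1983to89.B6GDVaLegKLevelV1
import Literature.MathematicalPhysics.QuantumFieldTheory.Balaban1983to89.B6Grad2LegLettersKLevelV1
import Literature.MathematicalPhysics.QuantumFieldTheory.Balaban1983to89.B6Prop26KLevelAssemblyV1

/-!
# `Balaban1983to89.B6DivLegNormSuppKLevelV1` — T. Bałaban, *Propagators and renormalization transformations for lattice gauge theories. II*,
# Commun. Math. Phys. **96** (1984) 223–250 [Balaban1984PropagatorsII], Prop. 2.6 (2.138)/(2.141) p. 247: THE RIGHT FACTOR `G_{□′}h_{□′}∇*_ν` OF THE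
# LAST LEGS `K_{□,□′}G_{□′}h_{□′}∇*_ν` OF THE WALK (2.141), PER CUBE, FOR THE GENUINE MEMBER ON THE V1 TORUS — its sup majorant in the (2.133) shape
# with the input weight `|c′|/L^{j(y′)}`, and its reading on the census Hölder class (the hypothesis `hX` of `…B6Ineq2134RightFactorA.h2134A_kFam_torus`)

statement-level skeleton of published theorems with citation tags; proofs where landed; nothing here is a claim about the Yang–Mills mass gap

WHAT IS PRINTED (p. 247 [PDF 25]): *"|(K_{□,□′}G_{□′}h_{□′}J)(x)| ≤ O(M⁻¹)e^{−½δ₂d(y,y′)}|J| (2.134) … The operator G can be represented as G = G₀(I − R)⁻¹ =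
Σ G₀Rⁿ (2.141) and the series above is convergent in the norms appearing in the inequalities (2.136)–(2.140)"*; p. 246 (Prop. 2.5): *"The operator G_□
… satisfies all the inequalities (1.110)–(1.114) of the Proposition 1.2 with a positive constant δ₂ instead of δ₀"*; [4] (1.110) p. 35: *"|(G∇*J)(x)| ≤
O(1)Lʲη e^{−δ₀|y−y′|}|J|"*.

CITATION HEADER (lean-in-tree rule) — WHAT IS REPRODUCED.  Cell `pub-ymgap`, seat `pub-ymgap-dag-n03-b` (FIRST-MISSING-ESTIMATE for DAG node N03 = [B6];
module (L2a) of the (2.138) programme: `…B6Ineq2138KLevelSkeletonV1` (the walk GIVEN the last legs), `…B6Ineq2134RightFactorA` (the kernels (2.92)/(2.93)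
against an abstract right factor), THIS FILE (the right factor), then the assembly).  In the last legs of (2.141) for `∇G∇*` the right factor after the
kernel `K_{□,□′}` is `X_{□′} = G_{□′}h_{□′}∇*_ν`; every line of (2.92)/(2.93) except the first-order part of line 1 sees `X_{□′}` through its SUP majorant
([4] (1.110)₃ for the member, transplanted).  THIS FILE:
* §1 `hasMajorant_in_mul_mulOp` (an input-localised majorant followed by a bounded right multiplier supported over the reach: global majorant with the
  input indicator); the operator identity **`mulOp_hB_mul_DVa`**: `h_□·∇*_ν = (c′/L^{j₀})•E_(ν,−)·(S_νh_□)· + (∇_νh_□)·` — the transpose of gen-30's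
  `…B6GradLegKLevelV1.DV_mul_mulOp` ∘ `mulOp_mul_EC_true` (`tr_EC`, `tr_DV`);
* §2 **`hGhDVa_cube`** — for the weight band `[a₀, a₁]` there are `ρ_X > 0`, `C_X ≥ 0` such that on every admissible V1 torus (`M_h = Lᵃ ≥ 8`, `R ≥ 2L²`,
  `P′ ≥ 5`, `L ≥ 5`, cube placed), for every `c′ ≠ 0`, weights `w`, direction `ν` and cube `□`:
  `HasMajorant (geomT D) (blkV1 hN D) (G_□·h_□·∇*_ν) (1_{Q_□}(y′)·C_X·(L^{j(y)}/c′)²·(|c′|/L^{j(y′)})·e^{−ρ_X d_T(y,y′)})` — print's `O(1)Lʲη e^{−δd}|J|` for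
  `G∇*` with the prefactor split as `(Lʲη)²` at the OUTPUT block (the (2.133) shape the kernels consume) times `(L^{j′}η)⁻¹` at the INPUT block (the weight
  `Q(y′)` of the (2.138) chain), from p38's `hGEin_cube` (`G_□E_(ν,−)`, input-localised) and r03's `hGin_cube` (`G_□`) with the supports/sizes of `S_νh_□`,
  `∇_νh_□` (`…B6Grad2LegLettersKLevelV1`), the level bookkeeping `L^{j(y′)} ≤ L²·L^{j₀}` on `□⁺` (`level_le_of_mem_QT`, `j0_le_level`);
* §3 **`hGhDVa_cube_normSupp`** — the same for the rescaled `c′²•(G_□h_□∇*_ν)` on the census Hölder class «supp J ⊂ Δ(y′), ‖J‖_ε + |J| ≤ B» in the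
  (2.133)-shape `C_X·len(y)²·e^{−ρ_X d}·(|c′|/L^{j(y′)})` (`…hasMajorantA_normSupp_of_sup`; `c′²·(L^{j}/c′)² = len²`: `…sq_mul_pref`) — the hypothesis `hX` of
  `…B6Ineq2134RightFactorA.h2134A_kFam_torus` for the genuine family.
IMPORTS BY NAME, restating nothing.  THEOREMS ONLY (no `def`, no `def … : Prop`, no new hypothesis-shaped fact); standard axioms.

HONEST SCOPE / DIVERGENCES.  (1) Member inputs = the tree's transplanted two-scale estimates (p38/r03/p22); constants `ρ_X, C_X` on `d, L, a₀, a₁` only.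
(2) `L ≥ 5`, `M_h = Lᵃ ≥ 8`, `R ≥ 2L²`, `P′ ≥ 5`, cube placed (the V1 family).  (3) The first-order part of line 1 of (2.92) against this right factor on
Hölder inputs (the member (1.112)) is NOT here (module (L2b)).  Integer torus, lattice units; nothing on d = 4 or the continuum; NOT a node discharge; NOT
summit progress.  Unit `pub-ymgap-dag-n03-b` (gen 0), 2026-08-25.
-/

open scoped BigOperators
open Finset

namespace Literature.MathematicalPhysics.QuantumFieldTheory.Balaban1983to89.B6DivLegNormSuppKLevelV1

open LatticeFieldCalculus
open B6MultiLevelBoxOperator (N0 bigSide)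
open B6MultiLevelTorusOperator (TDomains)
open B6Cover236MultiLevelBlocks (cubes)
open B6Geom246MultiLevelBox (bset)
open B6Geom246MultiLevelTorus (geomT)
open B8Ineq192MultiLevelTorus (geomTB geomTB_len geomT_len)
open B6RandomWalk (HasMajorant hasMajorant_mono hasMajorant_add BlockSupp)
open B6RandomWalkInputNorm (HasMajorantA NormSupp hasMajorantA_mono hasMajorantA_smul)
open B6Prop26Gluing (mulOp mulOp_apply ind ind_nonneg ind_le_one ind_of_mem ind_of_not_mem blockSupp_mulOp mulOp_eq_zero_of_blockSupp)
open B6GlobalChartV1 (PV toBox blkV1 domT)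
open B6SectAOperatorsV1 (BondIdx)
open B6Partition118KLevelFineSizes (C1F C1F_nonneg)
open B6Partition118KLevelTorusCentral (one_le_of_four_le)
open B6Prop26KLevelSkeletonV1 (hB hB_apply ST mem_ST pref pref_nonneg abs_hB_le_one blkV1_mem_QT_of_hB_ne_zero)
open B6InMajorantTransplant (InMajorant)
open B6CubeWindowV1 (Placed j0 j0_le_level Gl one_le_of_eight_le four_le_of_five_le)
open B6Eq292MemberTorusV1 (EC)
open B6CubeInDecayV1 (hGin_cube)
open B6CubeRightLegsV1 (hGEin_cube)
open B6CubeCoeffSizesV1 (level_le_of_mem_QT)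
open B6Prop26KLevelAssemblyV1 (hasMajorant_smul sq_mul_pref)
open B6GradLegKLevelV1 (shB shB_apply DV DV_apply abs_DV_apply DV_mul_mulOp mulOp_mul_EC_true shB_hB_deep blkV1_mem_ST_of_hB_shift_ne_zero abs_hB_shift_sub_le)
open B6LapLegKLevelV1 (shBi shBi_apply DVa)
open B6OpTransposeV1 (tr tr_mul tr_add tr_smul tr_mulOp tr_EC)
open B6GDVaLegKLevelV1 (tr_DV)
open B6Grad2LegLettersKLevelV1 (hasMajorantA_normSupp_of_sup supp_shB_hB supp_DV_hB abs_DV_hB_le)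
open B6HolderNormV1 (holderV1 supNormV1 holderV1_nonneg abs_le_supNormV1)

noncomputable section

/-! ## §1  A right multiplier on an input-localised majorant; the operator identity `h_□·∇*_ν = (c′/L^{j₀})•E_(ν,−)·(S_νh_□) + (∇_νh_□)·` -/

section Generic

variable {g : B6.Geometry} {X : Type}

/-- **AN INPUT-LOCALISED MAJORANT FOLLOWED BY A BOUNDED RIGHT MULTIPLIER SUPPORTED OVER THE REACH**: `T` with the input-localised majorant `K ≥ 0` over `S`
(*"supp J ⊂ Δ(y′), y′ ∈ 𝔅 ∩ T_□"*, outputs anywhere) and `|h| ≤ t` supported within the blocks of `S` give `T·h ≺ 1_S(y′)·t·K(y,y′)` (inputs off `S` are killed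
by `h`; r03's `…B6Ineq2134DiagIn.hasMajorant_of_inMajorant` with a size `t` and the input indicator kept).
[cite: Balaban1984PropagatorsII, (2.133) p.247, (2.141) p.247, bookkeeping] -/
theorem hasMajorant_in_mul_mulOp (blk : X → g.Site) {T : Module.End ℝ (X → ℝ)} {h : X → ℝ} {S : Set g.Site}
    {K : g.Site → g.Site → ℝ} {t : ℝ} (hK : ∀ a b, 0 ≤ K a b) (ht : 0 ≤ t)
    (hhsupp : ∀ x, h x ≠ 0 → blk x ∈ S) (hhle : ∀ x, |h x| ≤ t) (hT : InMajorant blk T S K) :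
    HasMajorant blk (T * mulOp h) (fun a b => ind S b * (t * K a b)) := by
  intro y' μ B hμ x
  beta_reduce
  have hnn : 0 ≤ ind S y' * (t * K (blk x) y') * B := mul_nonneg (mul_nonneg (ind_nonneg _ _) (mul_nonneg ht (hK _ _))) hμ.nonneg
  rw [Module.End.mul_apply]
  by_cases hy : y' ∈ S
  · rw [ind_of_mem hy, one_mul]
    have hμ' : BlockSupp blk (mulOp h μ) y' (t * B) := by
      refine ⟨mul_nonneg ht hμ.nonneg, fun x' hx' => ?_, fun x' hx' => ?_⟩
      · rw [mulOp_apply, abs_mul]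
        exact mul_le_mul (hhle x') (hμ.bound x' hx') (abs_nonneg _) ht
      · rw [mulOp_apply, hμ.off x' hx', mul_zero]
    calc |T (mulOp h μ) x| ≤ K (blk x) y' * (t * B) := hT y' hy (mulOp h μ) (t * B) hμ' x
      _ = t * K (blk x) y' * B := by ring
  · rw [mulOp_eq_zero_of_blockSupp blk hhsupp hμ hy, map_zero, Pi.zero_apply, abs_zero]
    exact hnn

end Generic

section Cube

variable {d ℓ : ℕ} {hd : 1 ≤ d + 1} {hL : Odd (ℓ + 1) ∧ 1 < ℓ + 1} {a₀ a₁ : ℝ} {m K : ℕ} {Mh k R : ℕ} {P' : Fin (d + 1) → ℕ}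
variable (hN : ∀ μ, N0 ℓ Mh k P' μ = (PV d ℓ m K hd hL).sitesPerDir 0) {D : TDomains d ℓ Mh k P' R} (hk : k ≤ m + K)
  (hMh1 : 1 ≤ Mh) (hP4 : ∀ μ, 4 ≤ P' μ) {a : ℕ} (hMha : Mh = (ℓ + 1) ^ a) (c : ↥(cubes D.toDomains)) (ha : a₀ ≤ a₁)

/-- **`h_□·∇*_ν = (c′/L^{j₀})•(E_(ν,−)·(S_νh_□)·) + (∇_νh_□)·`** as operators on the global torus (`c′ ≠ 0`; cube placed, `M_h ≥ 8`, `R ≥ 2L²`): the transpose of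
`∇_ν·h_□ = (S_νh_□)·∇_ν + (∇_νh_□)·` (`DV_mul_mulOp`) with `(S_νh_□)·∇_ν = (c′/L^{j₀})•(S_νh_□)·E_(ν,+)` (`mulOp_mul_EC_true` on the 1-deep `S_νh_□`), read through
`(∇_ν)ᵀ = ∇*_ν`, `(E_(ν,+))ᵀ = E_(ν,−)`, `(χ·)ᵀ = χ·`.
[cite: Balaban1984PropagatorsII, (2.141) p.247 (the last leg `…G_{□}h_{□}` followed by `∇*`), (2.92) p.239 (line 1), (2.94) p.239] -/
theorem mulOp_hB_mul_DVa (hM8 : 8 ≤ Mh) (hR2 : 2 * (ℓ + 1) ^ 2 ≤ R) (hpl : Placed ℓ k P' c.1) (w : BondIdx (domT hN D hk) → ℝ)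
    {cf : ℝ} (hcf : cf ≠ 0) (ν : Fin (d + 1)) :
    mulOp (hB hN D c) * DVa (P := PV d ℓ m K hd hL) ν cf =
      (cf / (((ℓ + 1 : ℕ) : ℝ)) ^ j0 hMh1 hP4 c) •
          (EC hN hk hMh1 hP4 hMha c ha hpl w cf (ν, false) * mulOp (shB (P := PV d ℓ m K hd hL) ν (hB hN D c))) +
        mulOp (DV (P := PV d ℓ m K hd hL) ν cf (hB hN D c)) := by
  have hLj : ((((ℓ + 1 : ℕ) : ℝ)) ^ j0 hMh1 hP4 c) ≠ 0 := by positivity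
  -- the `∇_ν` side: `(S_νh_□)·E_(ν,+) = (L^{j₀}/c′)•(S_νh_□)·∇_ν`, the product rule, and the transposes of the atoms
  have key := mulOp_mul_EC_true hN hk hMh1 hP4 hMha c ha hpl w hcf ν (shB (P := PV d ℓ m K hd hL) ν (hB hN D c))
    (fun b hb => shB_hB_deep hN hk hMh1 hP4 hMha c ha hM8 hR2 hpl w cf ν b hb)
  have hprod := DV_mul_mulOp (P := PV d ℓ m K hd hL) ν cf (hB hN D c)
  have htrE := tr_EC hN hk hMh1 hP4 hMha c ha hpl w cf (ν, true)
  simp only [Bool.not_true] at htrE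
  have htrDv := tr_DV (P := PV d ℓ m K hd hL) ν cf
  have htrSh := tr_mulOp (shB (P := PV d ℓ m K hd hL) ν (hB hN D c))
  have htrDh := tr_mulOp (DV (P := PV d ℓ m K hd hL) ν cf (hB hN D c))
  have htrHm := tr_mulOp (hB hN D c)
  -- atoms
  generalize EC hN hk hMh1 hP4 hMha c ha hpl w cf (ν, true) = Et at key htrE
  generalize EC hN hk hMh1 hP4 hMha c ha hpl w cf (ν, false) = Ef at htrE ⊢
  generalize mulOp (shB (P := PV d ℓ m K hd hL) ν (hB hN D c)) = Sh at key hprod htrSh ⊢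
  generalize mulOp (DV (P := PV d ℓ m K hd hL) ν cf (hB hN D c)) = Dh at hprod htrDh ⊢
  generalize mulOp (hB hN D c) = Hm at hprod htrHm ⊢
  generalize DV (P := PV d ℓ m K hd hL) ν cf = Dv at key hprod htrDv
  generalize DVa (P := PV d ℓ m K hd hL) ν cf = Dva at htrDv ⊢
  -- algebra
  have key' : Sh * Dv = (cf / (((ℓ + 1 : ℕ) : ℝ)) ^ j0 hMh1 hP4 c) • (Sh * Et) := by
    rw [key, smul_smul, div_mul_div_comm, mul_comm cf, div_self (mul_ne_zero hLj hcf), one_smul]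
  have hD : Dv * Hm = (cf / (((ℓ + 1 : ℕ) : ℝ)) ^ j0 hMh1 hP4 c) • (Sh * Et) + Dh := by rw [hprod, key']
  have h := congrArg tr hD
  rw [tr_mul, htrHm, htrDv, tr_add, tr_smul, tr_mul, htrE, htrSh, htrDh] at h
  exact h

/-! ## §2  The sup majorant of `G_□h_□∇*_ν` in the (2.133) shape with the input weight `|c′|/L^{j(y′)}` -/

open Classical in
/-- **THE RIGHT FACTOR `G_□h_□∇*_ν` OF THE LAST LEGS OF (2.141), PER CUBE, FOR THE GENUINE MEMBER** (`L ≥ 5`): there are `ρ_X > 0`, `C_X ≥ 0` (on `d, L` and the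
weight band `[a₀, a₁]` only) such that on every admissible V1 torus (`M_h = Lᵃ ≥ 8`, `R ≥ 2L²`, `P′ ≥ 5`, cube placed), for every `c′ ≠ 0`, weights `w`,
direction `ν` and cube `□`: `HasMajorant (geomT D) (blkV1 hN D) (G_□·h_□·∇*_ν) (1_{Q_□}(y′)·C_X·(L^{j(y)}/c′)²·(|c′|/L^{j(y′)})·e^{−ρ_X d_T(y,y′)})` — print's
`|(G∇*J)(x)| ≤ O(1)Lʲη e^{−δd}|J|` with the prefactor split between the output block (`(Lʲη)²`, the (2.133) shape) and the input block (`(L^{j′}η)⁻¹`).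
[cite: Balaban1984PropagatorsII, Prop. 2.6 (2.136) p.247 («|(G∇*J)(x)| ≤ O(1)Lʲη…»), (2.141) p.247, (2.133) p.247, p.235; Balaban1984PropagatorsI, (1.110) p.35] -/
theorem hGhDVa_cube (d ℓ : ℕ) (hd : 1 ≤ d + 1) (hL : Odd (ℓ + 1) ∧ 1 < ℓ + 1) {a₀ a₁ : ℝ} (ha₀ : 0 < a₀) (ha₁ : a₀ ≤ a₁) :
    ∃ ρX : ℝ, 0 < ρX ∧ ∃ CX : ℝ, 0 ≤ CX ∧ ∀ (m K : ℕ) {Mh k R : ℕ} {P' : Fin (d + 1) → ℕ}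
      (hN : ∀ μ, N0 ℓ Mh k P' μ = (PV d ℓ m K hd hL).sitesPerDir 0) (D : TDomains d ℓ Mh k P' R) (hk : k ≤ m + K)
      (hMh1 : 1 ≤ Mh) (hP4 : ∀ μ, 4 ≤ P' μ) {a : ℕ} (hMha : Mh = (ℓ + 1) ^ a) (_ : 8 ≤ Mh) (_ : 2 * (ℓ + 1) ^ 2 ≤ R) (_ : ∀ μ, 5 ≤ P' μ)
      (_ : 4 ≤ ℓ) (c : ↥(cubes D.toDomains)) (hpl : Placed ℓ k P' c.1) (w : BondIdx (domT hN D hk) → ℝ) {cf : ℝ} (_ : cf ≠ 0) (ν : Fin (d + 1)),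
      HasMajorant (g := geomT D) (blkV1 hN D)
        (Gl hN hk hMh1 hP4 hMha c ha₁ hpl w cf * mulOp (hB hN D c) * DVa (P := PV d ℓ m K hd hL) ν cf)
        (fun y y' => ind (ST D hMh1 hP4 c) y' *
          (CX * pref cf y * (|cf| / (geomT D).len y') * Real.exp (-(ρX * (geomT D).dist y y')))) := by
  obtain ⟨ρG, hρG, CG, hCG, hGin⟩ := hGin_cube d ℓ hd hL ha₀ ha₁
  obtain ⟨ρE, hρE, CE, hCE, hGEin⟩ := hGEin_cube d ℓ hd hL ha₀ ha₁
  have hC1 := C1F_nonneg d ℓ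
  refine ⟨min ρG ρE, lt_min hρG hρE, (((ℓ + 1 : ℕ) : ℝ)) ^ 2 * CE + C1F d ℓ * CG, by positivity, ?_⟩
  intro m K Mh k R P' hN D hk hMh1 hP4 a hMha hM8 hR2 hP5 hℓ c hpl w cf hcf ν
  have hMh : 2 ≤ Mh := le_trans (by norm_num) hM8
  have hR : 2 * (ℓ + 1) ≤ R := le_trans (by nlinarith : 2 * (ℓ + 1) ≤ 2 * (ℓ + 1) ^ 2) hR2
  have hP : ∀ μ, 1 ≤ P' μ := one_le_of_four_le hP4
  have hdnn : ∀ y y' : (geomT D).Site, 0 ≤ (geomT D).dist y y' := fun _ _ => Nat.cast_nonneg _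
  set S := ST D hMh1 hP4 c with hS
  set tD : ℝ := |cf| * (C1F d ℓ / (8 / 5 * (bigSide ℓ Mh c.1.1 : ℝ))) with htD
  have htD0 : 0 ≤ tD := by positivity
  -- the two input-localised legs of the member, each with its right multiplier
  have hE := hGEin m K hN D hk hMh1 hP4 hMha hMh hR2 hℓ c hpl w cf (ν, false)
  have hG := hGin m K hN D hk hMh1 hP4 hMha hMh hR2 hℓ c hpl w cf
  have hT1 := hasMajorant_in_mul_mulOp (g := geomT D) (blkV1 hN D) (S := S) (t := 1) (h := shB (P := PV d ℓ m K hd hL) ν (hB hN D c))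
    (K := fun y y' => CE * pref cf y * Real.exp (-(ρE * (geomT D).dist y y')))
    (fun y y' => by have := pref_nonneg cf y; positivity) zero_le_one
    (supp_shB_hB hN hMh1 hP4 c hM8 hR hP5 ν) (fun b => by rw [shB_apply]; exact abs_hB_le_one hN D hMh1 hP c _) hE
  have hT2 := hasMajorant_in_mul_mulOp (g := geomT D) (blkV1 hN D) (S := S) (t := tD) (h := DV (P := PV d ℓ m K hd hL) ν cf (hB hN D c))
    (K := fun y y' => CG * pref cf y * Real.exp (-(ρG * (geomT D).dist y y')))
    (fun y y' => by have := pref_nonneg cf y; positivity) htD0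
    (supp_DV_hB hN hMh1 hP4 c hMh hM8 hR hP5 cf ν) (abs_DV_hB_le hN c hMh hR hP5 cf ν) hG
  -- the operator identity and the sum of the two majorants
  have eop : Gl hN hk hMh1 hP4 hMha c ha₁ hpl w cf * mulOp (hB hN D c) * DVa (P := PV d ℓ m K hd hL) ν cf =
      (cf / (((ℓ + 1 : ℕ) : ℝ)) ^ j0 hMh1 hP4 c) •
          (Gl hN hk hMh1 hP4 hMha c ha₁ hpl w cf * EC hN hk hMh1 hP4 hMha c ha₁ hpl w cf (ν, false) * mulOp (shB ν (hB hN D c))) +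
        Gl hN hk hMh1 hP4 hMha c ha₁ hpl w cf * mulOp (DV (P := PV d ℓ m K hd hL) ν cf (hB hN D c)) := by
    rw [mul_assoc, mulOp_hB_mul_DVa hN hk hMh1 hP4 hMha c ha₁ hM8 hR2 hpl w hcf ν, mul_add, mul_smul_comm, ← mul_assoc]
  rw [eop]
  have hT1' := hasMajorant_smul (g := geomT D) (blkV1 hN D) hT1 (cf / (((ℓ + 1 : ℕ) : ℝ)) ^ j0 hMh1 hP4 c)
  refine hasMajorant_mono _ (hasMajorant_add _ hT1' hT2) fun y y' => ?_
  -- the kernels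
  have habs : |cf / (((ℓ + 1 : ℕ) : ℝ)) ^ j0 hMh1 hP4 c| = |cf| / (((ℓ + 1 : ℕ) : ℝ)) ^ j0 hMh1 hP4 c := by
    rw [abs_div, abs_of_pos (by positivity : (0 : ℝ) < (((ℓ + 1 : ℕ) : ℝ)) ^ j0 hMh1 hP4 c)]
  rw [habs]
  by_cases hy' : y' ∈ S
  swap
  · rw [ind_of_not_mem hy']; simp
  rw [ind_of_mem hy']
  set dd := (geomT D).dist y y' with hdd
  have hd0 : 0 ≤ dd := hdnn y y'
  have eE : Real.exp (-(ρE * dd)) ≤ Real.exp (-(min ρG ρE * dd)) :=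
    Real.exp_le_exp.mpr (neg_le_neg (mul_le_mul_of_nonneg_right (min_le_right _ _) hd0))
  have eG : Real.exp (-(ρG * dd)) ≤ Real.exp (-(min ρG ρE * dd)) :=
    Real.exp_le_exp.mpr (neg_le_neg (mul_le_mul_of_nonneg_right (min_le_left _ _) hd0))
  set eρ := Real.exp (-(min ρG ρE * dd)) with heρ
  have heρ0 : 0 ≤ eρ := Real.exp_nonneg _
  have hpref := pref_nonneg cf y
  have hcfpos : 0 < |cf| := abs_pos.2 hcf
  -- the level bookkeeping on `□⁺`: `L^{j(y′)} ≤ L²·L^{j₀}` and `L^{j(y′)} ≤ S`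
  have hL1 : (1 : ℝ) ≤ ((ℓ + 1 : ℕ) : ℝ) := by exact_mod_cast Nat.succ_pos ℓ
  have hlev : y'.1.1 ≤ j0 hMh1 hP4 c + 2 := by
    have h1 := level_le_of_mem_QT hMh1 hP4 c hR ((mem_ST D hMh1 hP4 c y').1 hy')
    have h2 := (j0_le_level hMh1 hP4 c hL hR2).2
    omega
  have hlevc : y'.1.1 ≤ c.1.1 + 1 := level_le_of_mem_QT hMh1 hP4 c hR ((mem_ST D hMh1 hP4 c y').1 hy')
  have elen : (geomT D).len y' = (((ℓ + 1 : ℕ) : ℝ)) ^ y'.1.1 := by rw [geomT_len, mul_one]; push_cast; ring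
  have hleny : 0 < (geomT D).len y' := by rw [elen]; positivity
  -- `|c′|/L^{j₀} ≤ L²·|c′|/L^{j(y′)}`
  have hw1 : |cf| / (((ℓ + 1 : ℕ) : ℝ)) ^ j0 hMh1 hP4 c ≤ (((ℓ + 1 : ℕ) : ℝ)) ^ 2 * (|cf| / (geomT D).len y') := by
    rw [elen, mul_div_assoc', le_div_iff₀ (by positivity), div_mul_eq_mul_div, div_le_iff₀ (by positivity)]
    have hpow : (((ℓ + 1 : ℕ) : ℝ)) ^ y'.1.1 ≤ (((ℓ + 1 : ℕ) : ℝ)) ^ 2 * (((ℓ + 1 : ℕ) : ℝ)) ^ j0 hMh1 hP4 c := by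
      rw [← pow_add]; exact pow_le_pow_right₀ hL1 (by omega)
    calc |cf| * (((ℓ + 1 : ℕ) : ℝ)) ^ y'.1.1 ≤ |cf| * ((((ℓ + 1 : ℕ) : ℝ)) ^ 2 * (((ℓ + 1 : ℕ) : ℝ)) ^ j0 hMh1 hP4 c) :=
          mul_le_mul_of_nonneg_left hpow hcfpos.le
      _ = (((ℓ + 1 : ℕ) : ℝ)) ^ 2 * |cf| * (((ℓ + 1 : ℕ) : ℝ)) ^ j0 hMh1 hP4 c := by ring
  -- `t_D ≤ C1F·|c′|/L^{j(y′)}`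
  have hw2 : tD ≤ C1F d ℓ * (|cf| / (geomT D).len y') := by
    rw [htD, elen]
    have hS : (((ℓ + 1 : ℕ) : ℝ)) ^ y'.1.1 ≤ 8 / 5 * (bigSide ℓ Mh c.1.1 : ℝ) := by
      unfold bigSide; push_cast
      have hM : (1 : ℝ) ≤ Mh := by exact_mod_cast hMh1
      have h1 : (((ℓ + 1 : ℕ) : ℝ)) ^ y'.1.1 ≤ (((ℓ + 1 : ℕ) : ℝ)) ^ (c.1.1 + 1) := pow_le_pow_right₀ hL1 hlevc
      have h2 : (((ℓ + 1 : ℕ) : ℝ)) ^ (c.1.1 + 1) ≤ (Mh : ℝ) * (((ℓ + 1 : ℕ) : ℝ)) ^ (c.1.1 + 1) :=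
        le_mul_of_one_le_left (by positivity) hM
      have h3 : (0 : ℝ) ≤ (Mh : ℝ) * (((ℓ + 1 : ℕ) : ℝ)) ^ (c.1.1 + 1) := by positivity
      push_cast at h1 h2 h3 ⊢
      nlinarith
    have hpos : (0 : ℝ) < (((ℓ + 1 : ℕ) : ℝ)) ^ y'.1.1 := by positivity
    calc |cf| * (C1F d ℓ / (8 / 5 * (bigSide ℓ Mh c.1.1 : ℝ)))
        ≤ |cf| * (C1F d ℓ / (((ℓ + 1 : ℕ) : ℝ)) ^ y'.1.1) :=
          mul_le_mul_of_nonneg_left (div_le_div_of_nonneg_left hC1 hpos hS) hcfpos.le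
      _ = C1F d ℓ * (|cf| / (((ℓ + 1 : ℕ) : ℝ)) ^ y'.1.1) := by ring
  have hQ0 : 0 ≤ |cf| / (geomT D).len y' := div_nonneg hcfpos.le hleny.le
  calc |cf| / (((ℓ + 1 : ℕ) : ℝ)) ^ j0 hMh1 hP4 c * (1 * (1 * (CE * pref cf y * Real.exp (-(ρE * dd))))) +
        1 * (tD * (CG * pref cf y * Real.exp (-(ρG * dd))))
      ≤ (((ℓ + 1 : ℕ) : ℝ)) ^ 2 * (|cf| / (geomT D).len y') * (1 * (1 * (CE * pref cf y * eρ))) +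
        1 * (C1F d ℓ * (|cf| / (geomT D).len y') * (CG * pref cf y * eρ)) := by
        gcongr
    _ = 1 * (((((ℓ + 1 : ℕ) : ℝ)) ^ 2 * CE + C1F d ℓ * CG) * pref cf y * (|cf| / (geomT D).len y') * eρ) := by ring

/-! ## §3  The reading on the census Hölder class, rescaled by `c′²` (the hypothesis `hX` of the (2.134) family theorem) -/

open Classical in
/-- **`c′²•(G_□h_□∇*_ν)` ON THE CENSUS HÖLDER CLASS IN THE (2.133) SHAPE**: for every `ε`, on the class «supp J ⊂ Δ(y′), ‖J‖_ε + |J| ≤ B»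
(`NormSupp (blkV1) {y′} (holderV1 ε + supNormV1)`): `c′²•(G_□h_□∇*_ν) ≺_adm C_X·len(y)²·e^{−ρ_X d_T(y,y′)}·(|c′|/L^{j(y′)})` (`len = L^j` of `geomTB D`) — the
sup letter of §2 read on the class (the size dominates `|J|`), the input indicator dropped, `c′²·(L^{j}/c′)² = len²`.
[cite: Balaban1984PropagatorsII, Prop. 2.6 (2.138) p.247, (2.141) p.247, (2.133) p.247, (2.94) p.239; Balaban1984PropagatorsI, (1.110) p.35] -/
theorem hGhDVa_cube_normSupp (d ℓ : ℕ) (hd : 1 ≤ d + 1) (hL : Odd (ℓ + 1) ∧ 1 < ℓ + 1) {a₀ a₁ : ℝ} (ha₀ : 0 < a₀) (ha₁ : a₀ ≤ a₁) :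
    ∃ ρX : ℝ, 0 < ρX ∧ ∃ CX : ℝ, 0 ≤ CX ∧ ∀ (m K : ℕ) {Mh k R : ℕ} {P' : Fin (d + 1) → ℕ}
      (hN : ∀ μ, N0 ℓ Mh k P' μ = (PV d ℓ m K hd hL).sitesPerDir 0) (D : TDomains d ℓ Mh k P' R) (hk : k ≤ m + K)
      (hMh1 : 1 ≤ Mh) (hP4 : ∀ μ, 4 ≤ P' μ) {a : ℕ} (hMha : Mh = (ℓ + 1) ^ a) (_ : 8 ≤ Mh) (_ : 2 * (ℓ + 1) ^ 2 ≤ R) (_ : ∀ μ, 5 ≤ P' μ)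
      (_ : 4 ≤ ℓ) (c : ↥(cubes D.toDomains)) (hpl : Placed ℓ k P' c.1) (w : BondIdx (domT hN D hk) → ℝ) {cf : ℝ} (_ : cf ≠ 0) (ν : Fin (d + 1)) (ε : ℝ),
      HasMajorantA (g := geomT D) (blkV1 hN D)
        (NormSupp (g := geomT D) (blkV1 hN D) (fun y' => ({y'} : Set (geomT D).Site)) (fun _ J => holderV1 hN D ε J + supNormV1 J))
        (cf ^ 2 • (Gl hN hk hMh1 hP4 hMha c ha₁ hpl w cf * mulOp (hB hN D c) * DVa (P := PV d ℓ m K hd hL) ν cf))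
        (fun y y' => CX * (geomTB D).len y ^ 2 * Real.exp (-(ρX * (geomT D).dist y y')) * (|cf| / (geomT D).len y')) := by
  obtain ⟨ρX, hρX, CX, hCX, H⟩ := hGhDVa_cube d ℓ hd hL ha₀ ha₁
  refine ⟨ρX, hρX, CX, hCX, ?_⟩
  intro m K Mh k R P' hN D hk hMh1 hP4 a hMha hM8 hR2 hP5 hℓ c hpl w cf hcf ν ε
  have h0 := H m K hN D hk hMh1 hP4 hMha hM8 hR2 hP5 hℓ c hpl w hcf ν
  have h1 := hasMajorant_smul (g := geomT D) (blkV1 hN D) h0 (cf ^ 2)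
  have hsupN : ∀ (y' : (geomT D).Site) (J : PBond (PV d ℓ m K hd hL) 0 → ℝ) (x : PBond (PV d ℓ m K hd hL) 0),
      |J x| ≤ holderV1 hN D ε J + supNormV1 J :=
    fun y' J x => (abs_le_supNormV1 J x).trans (le_add_of_nonneg_left (holderV1_nonneg hN D ε J))
  have h2 := hasMajorantA_normSupp_of_sup (g := geomT D) (blkV1 hN D) (N := fun _ J => holderV1 hN D ε J + supNormV1 J) hsupN h1
  refine hasMajorantA_mono (g := geomT D) (blkV1 hN D) h2 (fun _ _ _ hμ => hμ.nonneg) fun y y' => ?_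
  have hcf2 : |cf ^ 2| = cf ^ 2 := abs_of_nonneg (sq_nonneg _)
  rw [hcf2]
  have hleny : 0 < (geomT D).len y' := by rw [geomT_len]; positivity
  have hK : 0 ≤ CX * pref cf y * (|cf| / (geomT D).len y') * Real.exp (-(ρX * (geomT D).dist y y')) := by
    have := pref_nonneg cf y
    have : 0 ≤ |cf| / (geomT D).len y' := div_nonneg (abs_nonneg _) hleny.le
    positivity
  calc cf ^ 2 * (ind (ST D hMh1 hP4 c) y' * (CX * pref cf y * (|cf| / (geomT D).len y') * Real.exp (-(ρX * (geomT D).dist y y'))))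
      ≤ cf ^ 2 * (1 * (CX * pref cf y * (|cf| / (geomT D).len y') * Real.exp (-(ρX * (geomT D).dist y y')))) :=
        mul_le_mul_of_nonneg_left (mul_le_mul_of_nonneg_right (ind_le_one _ _) hK) (sq_nonneg _)
    _ = CX * (cf ^ 2 * pref cf y) * Real.exp (-(ρX * (geomT D).dist y y')) * (|cf| / (geomT D).len y') := by ring
    _ = CX * (geomTB D).len y ^ 2 * Real.exp (-(ρX * (geomT D).dist y y')) * (|cf| / (geomT D).len y') := by rw [sq_mul_pref cf hcf y]

end Cube

end

end Literature.MathematicalPhysics.QuantumFieldTheory.Balaban1983to89.B6DivLegNormSuppKLevelV1
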